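import Mathlib
import HarnessLib
import Summits.ValiantsHypothesis.ValiantsHypothesis.Theses.MonotoneRestoration
import Literature.Computability.AlgebraicComplexity.ArithCircuit
import Literature.Computability.AlgebraicComplexity.ArithCircuitProofs
import Literature.Computability.AlgebraicComplexity.MonotoneStructure
import Literature.Computability.AlgebraicComplexity.PermanentIrreducible
import Literature.ModelTheory.FiniteModelTheory.CkEquiv
import Summits.ValiantsHypothesis.ValiantsHypothesis.Theorems.MonotoneRestorationMonotoneRestorationQPCosetCount
import Summits.ValiantsHypothesis.ValiantsHypothesis.Theorems.MonotoneRestorationMonotoneRestorationQPSymmetricLB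
import Summits.ValiantsHypothesis.ValiantsHypothesis.Theorems.MonotoneRestorationMonotoneRestorationQPSupportSymmetrisation
import Summits.ValiantsHypothesis.ValiantsHypothesis.Theorems.MonotoneRestorationMonotoneRestorationQPSparseRegime
import Summits.ValiantsHypothesis.ValiantsHypothesis.Theorems.MonotoneRestorationMonotoneRestorationQPBeta
import Literature.Computability.AlgebraicComplexity.SymmetricArithCircuit
import Literature.Computability.AlgebraicComplexity.DawarWilsenach2025Proofs
import Literature.GroupTheory.PermutationGroups.SmallIndexSubgroups
import Summits.ValiantsHypothesis.ValiantsHypothesis.Theorems.MonotoneRestorationQP.Negative.LoadBearing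
import Summits.ValiantsHypothesis.ValiantsHypothesis.Theorems.MonotoneRestorationMonotoneRestorationQPPermSupportCount

/-! TTRL-lite variant V19238 of stmt-ValiantsHypothesis-15886

Machine-generated helper (proved); move `lemma_proposal`, op `llm`: bridge from `MvPolynomial.bind₁`
of the row sums into `MvPolynomial.esymm` to Mathlib's `Multiset.esymm`.
See docs/architecture/ttrl-lite.md. -/

namespace Summit.ValiantsHypothesis.ValiantsHypothesis.Theorems

open Summit.ValiantsHypothesis.ValiantsHypothesis.Theses.MonotoneRestoration
open Literature.Computability.AlgebraicComplexity

/-- TTRL-lite variant V19238 of stmt-ValiantsHypothesis-15886: substituting the row sums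
`R i = ∑ j, X (i, j)` into the elementary symmetric polynomial `esymm (Fin n) NNReal d`
gives the multiset elementary symmetric function of the multiset of row sums
(bridge `bind₁ = aeval` + `MvPolynomial.aeval_esymm_eq_multiset_esymm`). -/
theorem stub_esymmRowSums_comp_var19238 :
    ∀ n d : ℕ, MvPolynomial.bind₁ (fun i : Fin n => ∑ j : Fin n, MvPolynomial.X (i, j))
      (MvPolynomial.esymm (Fin n) NNReal d) =
      ((Finset.univ : Finset (Fin n)).val.map fun i : Fin n =>
        ∑ j : Fin n, (MvPolynomial.X (i, j) : MvPolynomial (Fin n × Fin n) NNReal)).esymm d := by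
  intro n d
  rw [← MvPolynomial.aeval_eq_bind₁, MvPolynomial.aeval_esymm_eq_multiset_esymm]

end Summit.ValiantsHypothesis.ValiantsHypothesis.Theorems
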